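import Summits.QuantumFields.YangMills.Theorems.UnitScaleTiltProp7DoubleCommutatorChain
import HarnessLib

/-!
# Route `UnitScaleTilt`, crux K1 «MinimiserStabilityRegPr» (stmt-QuantumFields-19200), route-R E′, S3 K-form engine, ROW (H) — hLap INHABITANT, FILE B′ (abstract letters):
# LOCALISATION OF A RUNG DIFFERENCE — `TPT⁻¹ − T′P′T′⁻¹ = T(P − Q)T⁻¹ − T(GQG⁻¹ − Q)T⁻¹` with `Q = bP′b⁻¹` the neighbouring plaquette transported along the bond (the pair of
# ✓ `Prop7CurrentConjugationDefect`) and `G = T⁻¹T′b⁻¹` the comb loop; the transport defect `GQG⁻¹ − Q` in COMMUTATOR currency by Jacobi: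
# `N_m(GQG⁻¹ − Q) ≤ 2‖G − 1‖·N_m(Q) + 2‖Q − 1‖(1 + ‖G − 1‖)·N_m(G)` — never `‖m‖`

Cell `ym3-torus`, width seat `ym3-torus-px4` (gen 4); ★ym-ust-19200-p1 g16 NAMER WORD 14 «px4 g4: hLap INHABITANT GO» (2026-08-29 00:17Z), road (iii) (★w4 g7 00:26Z) of this
seat's LOCATE-HLAP (19200 evidence #46).  THEOREMS ONLY (0 `def`, 0 `sorry`); `--supports stmt-QuantumFields-19200`, count-neutral.  YM₃ on T³ is a ladder rung (R3), not the
Clay problem; nothing here claims hLap, hRes, (H), S3, E′, a stub, the crux, d = 4 or the mass gap.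

WHY.  ✓ `Prop7LapDefectFirstOrder.norm_lapDefect_chain_add_comm_sum_le` leaves the Laplacian defect of a comb local model as (minus) the commutator of `m` with the SUM of the
rung differences `Δ_k = T_kP_kT_k⁻¹ − T′_kP′_kT′_k⁻¹` of two parallel thin loops.  Each `Δ_k` compares the plaquette `P_k` at a comb point `s_k`, transported to the centre along
the comb (`T_k`), with the plaquette `P′_k` at `s_k − e_μ`, transported along the SHIFTED comb (`T′_k`).  The bookable letter (✓ `Prop7CurrentConjugationDefect`, and the
current of the criticality row J-ROW★) is the LOCAL covariant difference `P_k − Q_k`, `Q_k = b_kP′_kb_k⁻¹` = `P′_k` transported along the one bond from `s_k − e_μ` to `s_k`; the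
two transports differ by the loop `G_k = T_k⁻¹T′_kb_k⁻¹` (a ladder of `k` plaquettes along the comb), and re-transporting a plaquette around a loop costs, in commutator currency,
(loop size) × (plaquette commutator) + (plaquette size) × (loop commutator) — by the product rule and the Jacobi identity, with NO absolute `‖m‖` (the LOCATE's (G4)).

WHAT IS PROVED (ns `…Theorems.Prop7RungDifferenceLocal`; `𝔸` a normed ring).
* `rung_sub_rung_eq_local` (the exact localisation), ★ `comm_comm_le` (Jacobi: `‖[[A,X],m]‖ ≤ 2‖A‖·‖[X,m]‖ + 2‖X‖·‖[A,m]‖`), ★★ `comm_conj_sub_self_le`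
  (`N_m(GQG⁻¹ − Q) ≤ 2‖G − 1‖·N_m(Q) + 2‖Q − 1‖·(1 + ‖G − 1‖)·N_m(G)`), ★★ `comm_rung_sub_rung_sub_local_le` (`‖[TPT⁻¹ − T′P′T′⁻¹, m] − [T(P − Q)T⁻¹, m]‖ ≤` the Jacobi bound
  at `m_T = R(T⁻¹)m`), ★★★ `comm_sum_rung_sub_sum_local_le` (summed over rungs: `‖[Σ_k Δ_k, m] − [Σ_k T_k(P_k − Q_k)T_k⁻¹, m]‖ ≤ Σ_k (Jacobi_k)`).
HONEST SCOPE.  Pure normed-ring algebra; no lattice, no comb, no count.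

References: T. Bałaban, CMP 99 (1985) 75–102 [Balaban1985RegularSpaces] ((1.1)–(1.2) p.76, (1.9) p.77); CMP 98 (1985) 17–51 [Balaban1985Averaging] ((19)–(20) p.21);
CMP 99 (1985) 389–434 [Balaban1985BackgroundPropagators] ((3.8)–(3.9) p.392).
-/

set_option autoImplicit false

noncomputable section

open scoped BigOperators

namespace Summit.QuantumFields.YangMills.Theorems.Prop7RungDifferenceLocal

open Literature.MathematicalPhysics.QuantumFieldTheory.Balaban1983to89
open B9Eq39Adjoint (R R_def)
open Summit.QuantumFields.YangMills.Theorems.Prop7CommutatorChain (comm_inv_le comm_sub_one)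

variable {𝔸 : Type*} [NormedRing 𝔸]

/-! ## Localisation of one rung difference: the bond-transported neighbour and the Jacobi bound -/

section Local

/-- the exact localisation: with `Q = bP′b⁻¹` (the neighbouring plaquette transported along the bond) and `G = T⁻¹T′b⁻¹` (the comb loop),
`TPT⁻¹ − T′P′T′⁻¹ = T(P − Q)T⁻¹ − T(GQG⁻¹ − Q)T⁻¹`. [cite: Balaban1985RegularSpaces, (1.1)-(1.2) p.76] -/
theorem rung_sub_rung_eq_local (T T' P P' b : 𝔸ˣ) :
    ((T * P * T⁻¹ : 𝔸ˣ) : 𝔸) - ((T' * P' * T'⁻¹ : 𝔸ˣ) : 𝔸)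
      = (T : 𝔸) * ((P : 𝔸) - ((b * P' * b⁻¹ : 𝔸ˣ) : 𝔸)) * ((T⁻¹ : 𝔸ˣ) : 𝔸)
        - (T : 𝔸) * ((((T⁻¹ * T' * b⁻¹) * (b * P' * b⁻¹) * (T⁻¹ * T' * b⁻¹)⁻¹ : 𝔸ˣ) : 𝔸) - ((b * P' * b⁻¹ : 𝔸ˣ) : 𝔸)) * ((T⁻¹ : 𝔸ˣ) : 𝔸) := by
  have key : (T⁻¹ * T' * b⁻¹) * (b * P' * b⁻¹) * (T⁻¹ * T' * b⁻¹)⁻¹ = T⁻¹ * (T' * P' * T'⁻¹) * T := by group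
  rw [key]
  simp only [Units.val_mul]
  set X : 𝔸 := (T' : 𝔸) * (P' : 𝔸) * ((T'⁻¹ : 𝔸ˣ) : 𝔸) with hX
  set Q : 𝔸 := (b : 𝔸) * (P' : 𝔸) * ((b⁻¹ : 𝔸ˣ) : 𝔸) with hQ
  have h1 : (T : 𝔸) * (((T⁻¹ : 𝔸ˣ) : 𝔸) * X * (T : 𝔸)) * ((T⁻¹ : 𝔸ˣ) : 𝔸) = X := by
    rw [← mul_assoc, ← mul_assoc, Units.mul_inv, one_mul, mul_assoc, Units.mul_inv, mul_one]
  have h2 : (T : 𝔸) * ((P : 𝔸) - Q) * ((T⁻¹ : 𝔸ˣ) : 𝔸) - (T : 𝔸) * (((T⁻¹ : 𝔸ˣ) : 𝔸) * X * (T : 𝔸) - Q) * ((T⁻¹ : 𝔸ˣ) : 𝔸)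
      = (T : 𝔸) * (P : 𝔸) * ((T⁻¹ : 𝔸ˣ) : 𝔸) - (T : 𝔸) * (((T⁻¹ : 𝔸ˣ) : 𝔸) * X * (T : 𝔸)) * ((T⁻¹ : 𝔸ˣ) : 𝔸) := by
    noncomm_ring
  rw [h2, h1]

/-- ★ **JACOBI IN COMMUTATOR CURRENCY**: `‖[[A, X], m]‖ ≤ 2‖A‖·‖[X, m]‖ + 2‖X‖·‖[A, m]‖` (`[[A,X],m] = [A,[X,m]] − [X,[A,m]]`). [folklore] -/
theorem comm_comm_le (A X m : 𝔸) :
    ‖(A * X - X * A) * m - m * (A * X - X * A)‖ ≤ 2 * ‖A‖ * ‖X * m - m * X‖ + 2 * ‖X‖ * ‖A * m - m * A‖ := by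
  have e : (A * X - X * A) * m - m * (A * X - X * A) = (A * (X * m - m * X) - (X * m - m * X) * A) - (X * (A * m - m * A) - (A * m - m * A) * X) := by
    noncomm_ring
  rw [e]
  refine (norm_sub_le _ _).trans (add_le_add ?_ ?_)
  · refine (norm_sub_le _ _).trans ?_
    have := norm_mul_le A (X * m - m * X); have := norm_mul_le (X * m - m * X) A; linarith
  · refine (norm_sub_le _ _).trans ?_
    have := norm_mul_le X (A * m - m * A); have := norm_mul_le (A * m - m * A) X; linarith

/-- ★★ **THE TRANSPORT DEFECT OF A PLAQUETTE IN COMMUTATOR CURRENCY**: for bi-contractive `G` and any unit `Q`,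
`N_m(GQG⁻¹ − Q) ≤ 2‖G − 1‖·N_m(Q) + 2‖Q − 1‖·(1 + ‖G − 1‖)·N_m(G)` (`GQG⁻¹ − Q = [G−1, Q−1]·G⁻¹`, the product rule, ✓ `comm_inv_le` and Jacobi) — re-transporting a plaquette around a
loop costs (loop size) × (plaquette commutator) + (plaquette size) × (loop commutator), never `‖m‖`. [cite: Balaban1985RegularSpaces, (1.1)-(1.2) p.76; Balaban1985Averaging, (19)-(20) p.21] -/
theorem comm_conj_sub_self_le {G : 𝔸ˣ} (hG : ‖(G : 𝔸)‖ ≤ 1 ∧ ‖((G⁻¹ : 𝔸ˣ) : 𝔸)‖ ≤ 1) (Q : 𝔸ˣ) (m : 𝔸) :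
    ‖(((G * Q * G⁻¹ : 𝔸ˣ) : 𝔸) - (Q : 𝔸)) * m - m * (((G * Q * G⁻¹ : 𝔸ˣ) : 𝔸) - (Q : 𝔸))‖
      ≤ 2 * ‖(G : 𝔸) - 1‖ * ‖(Q : 𝔸) * m - m * (Q : 𝔸)‖ + 2 * ‖(Q : 𝔸) - 1‖ * (1 + ‖(G : 𝔸) - 1‖) * ‖(G : 𝔸) * m - m * (G : 𝔸)‖ := by
  set A : 𝔸 := (G : 𝔸) - 1 with hA
  set X : 𝔸 := (Q : 𝔸) - 1 with hX
  set Y : 𝔸 := A * X - X * A with hY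
  -- `GQG⁻¹ − Q = Y·G⁻¹`
  have e1 : ((G * Q * G⁻¹ : 𝔸ˣ) : 𝔸) - (Q : 𝔸) = Y * ((G⁻¹ : 𝔸ˣ) : 𝔸) := by
    rw [hY, hA, hX, Units.val_mul, Units.val_mul]
    have hK : (G : 𝔸) * ((G⁻¹ : 𝔸ˣ) : 𝔸) = 1 := Units.mul_inv G
    calc (G : 𝔸) * (Q : 𝔸) * ((G⁻¹ : 𝔸ˣ) : 𝔸) - (Q : 𝔸) = (G : 𝔸) * (Q : 𝔸) * ((G⁻¹ : 𝔸ˣ) : 𝔸) - (Q : 𝔸) * ((G : 𝔸) * ((G⁻¹ : 𝔸ˣ) : 𝔸)) := by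
          rw [hK, mul_one]
      _ = _ := by noncomm_ring
  -- `[Y G⁻¹, m] = Y [G⁻¹, m] + [Y, m] G⁻¹`
  have e2 : (Y * ((G⁻¹ : 𝔸ˣ) : 𝔸)) * m - m * (Y * ((G⁻¹ : 𝔸ˣ) : 𝔸))
      = Y * (((G⁻¹ : 𝔸ˣ) : 𝔸) * m - m * ((G⁻¹ : 𝔸ˣ) : 𝔸)) + (Y * m - m * Y) * ((G⁻¹ : 𝔸ˣ) : 𝔸) := by noncomm_ring
  rw [e1, e2]
  have hYn : ‖Y‖ ≤ 2 * ‖A‖ * ‖X‖ := by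
    rw [hY]; refine (norm_sub_le _ _).trans ?_
    have := norm_mul_le A X; have := norm_mul_le X A; linarith
  have hGinv : ‖((G⁻¹ : 𝔸ˣ) : 𝔸) * m - m * ((G⁻¹ : 𝔸ˣ) : 𝔸)‖ ≤ ‖(G : 𝔸) * m - m * (G : 𝔸)‖ := comm_inv_le hG m
  have hXm : ‖X * m - m * X‖ = ‖(Q : 𝔸) * m - m * (Q : 𝔸)‖ := by rw [hX, ← comm_sub_one]
  have hAm : ‖A * m - m * A‖ = ‖(G : 𝔸) * m - m * (G : 𝔸)‖ := by rw [hA, ← comm_sub_one]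
  have hJ := comm_comm_le A X m
  rw [← hY, hXm, hAm] at hJ
  have t1 : ‖Y * (((G⁻¹ : 𝔸ˣ) : 𝔸) * m - m * ((G⁻¹ : 𝔸ˣ) : 𝔸))‖ ≤ 2 * ‖A‖ * ‖X‖ * ‖(G : 𝔸) * m - m * (G : 𝔸)‖ :=
    (norm_mul_le _ _).trans (mul_le_mul hYn hGinv (norm_nonneg _) (by positivity))
  have t2 : ‖(Y * m - m * Y) * ((G⁻¹ : 𝔸ˣ) : 𝔸)‖ ≤ 2 * ‖A‖ * ‖(Q : 𝔸) * m - m * (Q : 𝔸)‖ + 2 * ‖X‖ * ‖(G : 𝔸) * m - m * (G : 𝔸)‖ :=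
    (norm_mul_le _ _).trans ((mul_le_mul hJ hG.2 (norm_nonneg _) (by positivity)).trans (by rw [mul_one]))
  refine (norm_add_le _ _).trans ((add_le_add t1 t2).trans (le_of_eq ?_))
  rw [hA, hX]; ring

/-- ★★ **ONE RUNG DIFFERENCE, LOCALISED**: for bi-contractive `T` and `G := T⁻¹T′b⁻¹`, `Q := bP′b⁻¹`,
`‖[TPT⁻¹ − T′P′T′⁻¹, m] − [T(P − Q)T⁻¹, m]‖ ≤ 2‖G − 1‖·N_(m_T)(Q) + 2‖Q − 1‖(1 + ‖G − 1‖)·N_(m_T)(G)`, `m_T = R(T⁻¹)m` — the commutator with a rung difference IS the commutator with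
the transported LOCAL covariant curvature difference `P − Q`, up to commutator-currency second order. [cite: Balaban1985RegularSpaces, (1.1)-(1.2) p.76, (1.9) p.77] -/
theorem comm_rung_sub_rung_sub_local_le {T : 𝔸ˣ} (hT : ‖(T : 𝔸)‖ ≤ 1 ∧ ‖((T⁻¹ : 𝔸ˣ) : 𝔸)‖ ≤ 1) (T' P P' b : 𝔸ˣ)
    (hG : ‖((T⁻¹ * T' * b⁻¹ : 𝔸ˣ) : 𝔸)‖ ≤ 1 ∧ ‖(((T⁻¹ * T' * b⁻¹)⁻¹ : 𝔸ˣ) : 𝔸)‖ ≤ 1) (m : 𝔸) :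
    ‖((((T * P * T⁻¹ : 𝔸ˣ) : 𝔸) - ((T' * P' * T'⁻¹ : 𝔸ˣ) : 𝔸)) * m - m * (((T * P * T⁻¹ : 𝔸ˣ) : 𝔸) - ((T' * P' * T'⁻¹ : 𝔸ˣ) : 𝔸)))
        - (((T : 𝔸) * ((P : 𝔸) - ((b * P' * b⁻¹ : 𝔸ˣ) : 𝔸)) * ((T⁻¹ : 𝔸ˣ) : 𝔸)) * m - m * ((T : 𝔸) * ((P : 𝔸) - ((b * P' * b⁻¹ : 𝔸ˣ) : 𝔸)) * ((T⁻¹ : 𝔸ˣ) : 𝔸)))‖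
      ≤ 2 * ‖((T⁻¹ * T' * b⁻¹ : 𝔸ˣ) : 𝔸) - 1‖ * ‖((b * P' * b⁻¹ : 𝔸ˣ) : 𝔸) * R T⁻¹ m - R T⁻¹ m * ((b * P' * b⁻¹ : 𝔸ˣ) : 𝔸)‖
        + 2 * ‖((b * P' * b⁻¹ : 𝔸ˣ) : 𝔸) - 1‖ * (1 + ‖((T⁻¹ * T' * b⁻¹ : 𝔸ˣ) : 𝔸) - 1‖)
          * ‖((T⁻¹ * T' * b⁻¹ : 𝔸ˣ) : 𝔸) * R T⁻¹ m - R T⁻¹ m * ((T⁻¹ * T' * b⁻¹ : 𝔸ˣ) : 𝔸)‖ := by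
  set G : 𝔸ˣ := T⁻¹ * T' * b⁻¹ with hGdef
  set Q : 𝔸ˣ := b * P' * b⁻¹ with hQdef
  set W : 𝔸 := ((G * Q * G⁻¹ : 𝔸ˣ) : 𝔸) - (Q : 𝔸) with hW
  rw [rung_sub_rung_eq_local T T' P P' b]
  simp only [← hGdef, ← hQdef]
  have e : ((T : 𝔸) * ((P : 𝔸) - (Q : 𝔸)) * ((T⁻¹ : 𝔸ˣ) : 𝔸) - (T : 𝔸) * W * ((T⁻¹ : 𝔸ˣ) : 𝔸)) * m
        - m * ((T : 𝔸) * ((P : 𝔸) - (Q : 𝔸)) * ((T⁻¹ : 𝔸ˣ) : 𝔸) - (T : 𝔸) * W * ((T⁻¹ : 𝔸ˣ) : 𝔸))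
        - (((T : 𝔸) * ((P : 𝔸) - (Q : 𝔸)) * ((T⁻¹ : 𝔸ˣ) : 𝔸)) * m - m * ((T : 𝔸) * ((P : 𝔸) - (Q : 𝔸)) * ((T⁻¹ : 𝔸ˣ) : 𝔸)))
      = -(((T : 𝔸) * W * ((T⁻¹ : 𝔸ˣ) : 𝔸)) * m - m * ((T : 𝔸) * W * ((T⁻¹ : 𝔸ˣ) : 𝔸))) := by
    noncomm_ring
  rw [← hW, e, norm_neg]
  -- `[T W T⁻¹, m] = T [W, R(T⁻¹)m] T⁻¹`
  have hK : (T : 𝔸) * ((T⁻¹ : 𝔸ˣ) : 𝔸) = 1 := Units.mul_inv T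
  have eC : ((T : 𝔸) * W * ((T⁻¹ : 𝔸ˣ) : 𝔸)) * m - m * ((T : 𝔸) * W * ((T⁻¹ : 𝔸ˣ) : 𝔸)) = (T : 𝔸) * (W * R T⁻¹ m - R T⁻¹ m * W) * ((T⁻¹ : 𝔸ˣ) : 𝔸) := by
    rw [R_def, inv_inv]
    calc ((T : 𝔸) * W * ((T⁻¹ : 𝔸ˣ) : 𝔸)) * m - m * ((T : 𝔸) * W * ((T⁻¹ : 𝔸ˣ) : 𝔸))
        = ((T : 𝔸) * W * ((T⁻¹ : 𝔸ˣ) : 𝔸)) * m * ((T : 𝔸) * ((T⁻¹ : 𝔸ˣ) : 𝔸)) - ((T : 𝔸) * ((T⁻¹ : 𝔸ˣ) : 𝔸)) * m * ((T : 𝔸) * W * ((T⁻¹ : 𝔸ˣ) : 𝔸)) := by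
            rw [hK, mul_one, one_mul]
      _ = _ := by noncomm_ring
  rw [eC]
  have hWm : ‖W * R T⁻¹ m - R T⁻¹ m * W‖ ≤ 2 * ‖(G : 𝔸) - 1‖ * ‖(Q : 𝔸) * R T⁻¹ m - R T⁻¹ m * (Q : 𝔸)‖
      + 2 * ‖(Q : 𝔸) - 1‖ * (1 + ‖(G : 𝔸) - 1‖) * ‖(G : 𝔸) * R T⁻¹ m - R T⁻¹ m * (G : 𝔸)‖ := by
    rw [hW]; exact comm_conj_sub_self_le hG Q (R T⁻¹ m)
  calc ‖(T : 𝔸) * (W * R T⁻¹ m - R T⁻¹ m * W) * ((T⁻¹ : 𝔸ˣ) : 𝔸)‖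
      ≤ ‖(T : 𝔸)‖ * ‖W * R T⁻¹ m - R T⁻¹ m * W‖ * ‖((T⁻¹ : 𝔸ˣ) : 𝔸)‖ :=
        (norm_mul_le _ _).trans (mul_le_mul_of_nonneg_right (norm_mul_le _ _) (norm_nonneg _))
    _ ≤ 1 * ‖W * R T⁻¹ m - R T⁻¹ m * W‖ * 1 := mul_le_mul (mul_le_mul_of_nonneg_right hT.1 (norm_nonneg _)) hT.2 (norm_nonneg _) (by positivity)
    _ = ‖W * R T⁻¹ m - R T⁻¹ m * W‖ := by ring
    _ ≤ _ := hWm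

/-- ★★★ **THE SUM OF THE RUNG DIFFERENCES, LOCALISED**: for bi-contractive `T_k` and comb loops `G_k := T_k⁻¹T′_kb_k⁻¹`, bond-transported neighbours `Q_k := b_kP′_kb_k⁻¹`,
`‖[Σ_(k<n)(T_kP_kT_k⁻¹ − T′_kP′_kT′_k⁻¹), m] − [Σ_(k<n) T_k(P_k − Q_k)T_k⁻¹, m]‖ ≤ Σ_(k<n) (2‖G_k − 1‖·N_(m_k)(Q_k) + 2‖Q_k − 1‖(1 + ‖G_k − 1‖)·N_(m_k)(G_k))`, `m_k = R(T_k⁻¹)m`.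
[cite: Balaban1985RegularSpaces, (1.1)-(1.2) p.76, (1.9) p.77; Balaban1985Averaging, (19)-(20) p.21] -/
theorem comm_sum_rung_sub_sum_local_le (T T' P P' b : ℕ → 𝔸ˣ) (hT : ∀ k, ‖(T k : 𝔸)‖ ≤ 1 ∧ ‖(((T k)⁻¹ : 𝔸ˣ) : 𝔸)‖ ≤ 1)
    (hG : ∀ k, ‖(((T k)⁻¹ * T' k * (b k)⁻¹ : 𝔸ˣ) : 𝔸)‖ ≤ 1 ∧ ‖((((T k)⁻¹ * T' k * (b k)⁻¹)⁻¹ : 𝔸ˣ) : 𝔸)‖ ≤ 1) (m : 𝔸) (n : ℕ) :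
    ‖((∑ k ∈ Finset.range n, (((T k * P k * (T k)⁻¹ : 𝔸ˣ) : 𝔸) - ((T' k * P' k * (T' k)⁻¹ : 𝔸ˣ) : 𝔸))) * m
          - m * ∑ k ∈ Finset.range n, (((T k * P k * (T k)⁻¹ : 𝔸ˣ) : 𝔸) - ((T' k * P' k * (T' k)⁻¹ : 𝔸ˣ) : 𝔸)))
        - ((∑ k ∈ Finset.range n, (T k : 𝔸) * ((P k : 𝔸) - ((b k * P' k * (b k)⁻¹ : 𝔸ˣ) : 𝔸)) * (((T k)⁻¹ : 𝔸ˣ) : 𝔸)) * m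
          - m * ∑ k ∈ Finset.range n, (T k : 𝔸) * ((P k : 𝔸) - ((b k * P' k * (b k)⁻¹ : 𝔸ˣ) : 𝔸)) * (((T k)⁻¹ : 𝔸ˣ) : 𝔸))‖
      ≤ ∑ k ∈ Finset.range n,
          (2 * ‖(((T k)⁻¹ * T' k * (b k)⁻¹ : 𝔸ˣ) : 𝔸) - 1‖ * ‖((b k * P' k * (b k)⁻¹ : 𝔸ˣ) : 𝔸) * R (T k)⁻¹ m - R (T k)⁻¹ m * ((b k * P' k * (b k)⁻¹ : 𝔸ˣ) : 𝔸)‖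
            + 2 * ‖((b k * P' k * (b k)⁻¹ : 𝔸ˣ) : 𝔸) - 1‖ * (1 + ‖(((T k)⁻¹ * T' k * (b k)⁻¹ : 𝔸ˣ) : 𝔸) - 1‖)
              * ‖(((T k)⁻¹ * T' k * (b k)⁻¹ : 𝔸ˣ) : 𝔸) * R (T k)⁻¹ m - R (T k)⁻¹ m * (((T k)⁻¹ * T' k * (b k)⁻¹ : 𝔸ˣ) : 𝔸)‖) := by
  -- the difference of the two commutators is the sum over rungs of the per-rung differences
  set Δ : ℕ → 𝔸 := fun k => ((T k * P k * (T k)⁻¹ : 𝔸ˣ) : 𝔸) - ((T' k * P' k * (T' k)⁻¹ : 𝔸ˣ) : 𝔸) with hΔ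
  set Λ : ℕ → 𝔸 := fun k => (T k : 𝔸) * ((P k : 𝔸) - ((b k * P' k * (b k)⁻¹ : 𝔸ˣ) : 𝔸)) * (((T k)⁻¹ : 𝔸ˣ) : 𝔸) with hΛ
  have e : ((∑ k ∈ Finset.range n, Δ k) * m - m * ∑ k ∈ Finset.range n, Δ k) - ((∑ k ∈ Finset.range n, Λ k) * m - m * ∑ k ∈ Finset.range n, Λ k)
      = ∑ k ∈ Finset.range n, ((Δ k * m - m * Δ k) - (Λ k * m - m * Λ k)) := by
    simp only [Finset.sum_sub_distrib, Finset.sum_mul, Finset.mul_sum]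
  rw [e]
  refine (norm_sum_le _ _).trans (Finset.sum_le_sum fun k _ => ?_)
  simp only [hΔ, hΛ]
  exact comm_rung_sub_rung_sub_local_le (hT k) (T' k) (P k) (P' k) (b k) (hG k) m

end Local

end Summit.QuantumFields.YangMills.Theorems.Prop7RungDifferenceLocal

end
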